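import Literature.Probability.LatticeModels.LocalPerturbationObservablesBounds
import HarnessLib

/-!
# Crux `IR` (stmt-QuantumFields-19354), lane B: lattice-animal counting of seeded cell sets at small fugacity, and the
# KOTECKÝ–PREISS-GRADE observable bound for local perturbations (part 1/2 of the sharp constant; generic, route-independent, Theses-free)

Helper module for item `stmt-QuantumFields-19354` (`--supports`; it closes nothing), lane `ym-19354-onsetsc-p2` (owner R98 (1): «a
cluster-expansion version over the same `pertExpect` format should bring a⋆ down — second file»).  Everything here is stated for the
tree's ABSTRACT local-perturbation layer (`Literature.Probability.LatticeModels.LocalPerturbation*`: cells `V`, adjacency `R` with `≤ Δ`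
neighbours, reference `μ`, cell factors `‖g p‖ ≤ ε`, `pertExpect`) and reuses its seeded resummation BY NAME; only the COUNTING changes.

* §1 `sum_pow_card_le_of_isSeeded_sharp` — `Σ_{A ⊆ P seeded by S} x^{#A} ≤ (1 + 2x)^{#S}` whenever `0 ≤ x` and `(1 + 2x)^D ≤ 2`
  (the tree's Peierls bound `Polymer.sum_pow_card_le_of_isSeeded`, `≤ 2^{#S}` at `x ≤ 2^{-D}`, re-run with base `1 + 2x`: the peeling
  step is `1 + x (1+2x)^D ≤ 1 + 2x`); `sum_pow_card_nonempty_le_of_isSeeded_sharp` (`≤ (1+2x)^{#S} − 1` over non-empty `A`).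
* §2 with `fug ε Δ = ε e^{2eε(Δ+1)²}` (the renormalised fugacity): `sum_seeded_pow_le_sharp`, `norm_sum_seeded_nonempty_le_sharp`,
  `norm_one_sub_pertZ_sdiff_div_le_sharp` (`‖1 − Z(C∖D)/Z(C)‖ ≤ e^{2eε(Δ+1)#D}((1+2ε₁)^{#D} − 1)`) and
  **`norm_pertExpect_sub_integral_le_sharp`**: under `eε(Δ+1)² ≤ 1/2` and `(1 + 2ε₁)^Δ ≤ 2`,
  `‖⟨F⟩_C − ∫ F dμ‖ ≤ 2 B e^{2eε(Δ+1)#T} ((1 + 2ε₁)^{#T} − 1)`, `T = touchCells R S C` — of order `B (Δ+1)² #S ε` against the tree's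
  `2 e B ε 2^Δ (2e)^{#T}` (`norm_pertExpect_sub_integral_le`); volume-uniform, complex activities allowed.
Part 2/2 (`Theorems/IR/BlockedActivityKP`) specialises to the lane's cells (`Δ = 81`, `#T ≤ 82`): `radiusKP ε = ε ∕ (13448 e²)`.

HONEST FRAMING: a counting lemma and an abstract expansion bound; nothing about Yang–Mills; not a gap, not Clay.  No `sorry`; axioms ⊆
{propext, Classical.choice, Quot.sound}; no instances, no notation.
Refs: KoteckyPreiss1986 (1); FriedliVelenik2017 §5.2, §5.7.1; SeilerLNP1982 proof of Thm. 3.2; OsterwalderSeilerAnnPhys1978 Lemma 5.2, §3.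
-/

set_option autoImplicit false

noncomputable section

open MeasureTheory ProbabilityTheory Finset
open Literature.MathematicalPhysics.QuantumFieldTheory (cofree mem_cofree cofree_subset)
open Literature.MathematicalPhysics.QuantumFieldTheory.Polymer (IsSeeded isSeeded_empty isSeeded_erase_iff eq_empty_of_isSeeded)
open Literature.Probability.LatticeModels

namespace Summit.QuantumFields.YangMills.Cruxes.IR.BlockedActivity.KP

/-! ## §1 Lattice-animal counting of seeded sets at small fugacity -/

section Counting

variable {ι : Type*} {adj : ι → ι → Prop}

open scoped Classical in
/-- **Seeded sets at small fugacity.**  If every cell has at most `D` neighbours (`nbr a ∋ b` whenever `adj a b`, `#nbr a ≤ D`),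
`0 ≤ x` and `(1 + 2x)^D ≤ 2`, then `Σ_{A ⊆ P seeded by S} x^{#A} ≤ (1 + 2x)^{#S}` — the tree's Peierls bound
`Polymer.sum_pow_card_le_of_isSeeded` (`≤ 2^{#S}` at `x ≤ 2^{-D}`) re-run with the base `1 + 2x` in place of `2` (same peeling
induction: `1 + x (1+2x)^D ≤ 1 + 2x`). -/
theorem sum_pow_card_le_of_isSeeded_sharp (nbr : ι → Finset ι) (hnbr : ∀ a b, adj a b → b ∈ nbr a)
    (D : ℕ) (hD : ∀ a, (nbr a).card ≤ D) {x : ℝ} (hx0 : 0 ≤ x) (hx : (1 + 2 * x) ^ D ≤ 2)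
    (P S : Finset ι) :
    ∑ A ∈ P.powerset with IsSeeded adj S A, x ^ A.card ≤ (1 + 2 * x) ^ S.card := by
  set θ : ℝ := 1 + 2 * x with hθ
  have hθ1 : 1 ≤ θ := by rw [hθ]; linarith
  induction P using Finset.strongInductionOn generalizing S with
  | _ P ih => ?_
  by_cases hPS : ∃ s ∈ P, s ∈ S
  · obtain ⟨s, hsP, hsS⟩ := hPS
    have hP : P = insert s (P.erase s) := (insert_erase hsP).symm
    have hs' : s ∉ P.erase s := Finset.notMem_erase s P
    have hsub : P.erase s ⊂ P := erase_ssubset hsP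
    rw [hP, sum_filter, sum_powerset_insert hs']
    have h1 : ∑ t ∈ (P.erase s).powerset, (if IsSeeded adj S t then x ^ t.card else 0) ≤
        θ ^ (S.erase s).card := by
      have := ih (P.erase s) hsub (S.erase s)
      rw [sum_filter] at this
      refine le_of_eq_of_le (sum_congr rfl fun t ht => ?_) this
      have hst : s ∉ t := fun h => hs' (mem_powerset.mp ht h)
      simp only [isSeeded_erase_iff hst]
    have h2 : ∑ t ∈ (P.erase s).powerset,
        (if IsSeeded adj S (insert s t) then x ^ (insert s t).card else 0) ≤
        x * θ ^ (S.erase s ∪ nbr s).card := by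
      have := ih (P.erase s) hsub (S.erase s ∪ nbr s)
      rw [sum_filter] at this
      calc ∑ t ∈ (P.erase s).powerset,
            (if IsSeeded adj S (insert s t) then x ^ (insert s t).card else 0)
          ≤ ∑ t ∈ (P.erase s).powerset,
            x * (if IsSeeded adj (S.erase s ∪ nbr s) t then x ^ t.card else 0) := by
            refine sum_le_sum fun t ht => ?_
            have hst : s ∉ t := fun h => hs' (mem_powerset.mp ht h)
            split_ifs with h1' h2'
            · rw [card_insert_of_notMem hst, pow_succ, mul_comm]
            · exact absurd (h1'.of_insert hst (hnbr s)) h2'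
            · positivity
            · simp
        _ = x * ∑ t ∈ (P.erase s).powerset,
            (if IsSeeded adj (S.erase s ∪ nbr s) t then x ^ t.card else 0) := by rw [mul_sum]
        _ ≤ x * θ ^ (S.erase s ∪ nbr s).card := mul_le_mul_of_nonneg_left this hx0
    have hcardS : S.card = (S.erase s).card + 1 := (card_erase_add_one hsS).symm
    have hcard2 : (S.erase s ∪ nbr s).card ≤ (S.erase s).card + D :=
      (card_union_le _ _).trans (Nat.add_le_add_left (hD s) _)
    calc _ ≤ θ ^ (S.erase s).card + x * θ ^ (S.erase s ∪ nbr s).card := add_le_add h1 h2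
      _ ≤ θ ^ (S.erase s).card + x * θ ^ ((S.erase s).card + D) := by
          gcongr
      _ = θ ^ (S.erase s).card * (1 + x * θ ^ D) := by ring
      _ ≤ θ ^ (S.erase s).card * θ := by
          refine mul_le_mul_of_nonneg_left ?_ (by positivity)
          rw [hθ] at hx ⊢
          nlinarith
      _ = θ ^ S.card := by rw [hcardS, pow_succ]
  · push Not at hPS
    have hsub : P.powerset.filter (IsSeeded adj S) ⊆ {∅} := by
      intro A hA
      rw [mem_filter, mem_powerset] at hA
      rw [mem_singleton]
      exact eq_empty_of_isSeeded hA.2 fun q hq => hPS q (hA.1 hq)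
    calc ∑ A ∈ P.powerset with IsSeeded adj S A, x ^ A.card
        ≤ ∑ A ∈ ({∅} : Finset (Finset ι)), x ^ A.card :=
          sum_le_sum_of_subset_of_nonneg hsub fun _ _ _ => by positivity
      _ = 1 := by simp
      _ ≤ θ ^ S.card := one_le_pow₀ hθ1

open scoped Classical in
/-- The NON-EMPTY seeded sets: `Σ_{∅ ≠ A ⊆ P seeded by S} x^{#A} ≤ (1 + 2x)^{#S} − 1`. -/
theorem sum_pow_card_nonempty_le_of_isSeeded_sharp (nbr : ι → Finset ι) (hnbr : ∀ a b, adj a b → b ∈ nbr a)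
    (D : ℕ) (hD : ∀ a, (nbr a).card ≤ D) {x : ℝ} (hx0 : 0 ≤ x) (hx : (1 + 2 * x) ^ D ≤ 2)
    (P S : Finset ι) :
    ∑ A ∈ (P.powerset.filter fun A => IsSeeded adj S A) with A.Nonempty, x ^ A.card ≤ (1 + 2 * x) ^ S.card - 1 := by
  have hfull := sum_pow_card_le_of_isSeeded_sharp nbr hnbr D hD hx0 hx P S
  have hmem : (∅ : Finset ι) ∈ P.powerset.filter fun A => IsSeeded adj S A :=
    mem_filter.2 ⟨empty_mem_powerset P, isSeeded_empty S⟩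
  have hsplit : ∑ A ∈ (P.powerset.filter fun A => IsSeeded adj S A) with A.Nonempty, x ^ A.card =
      ∑ A ∈ (P.powerset.filter fun A => IsSeeded adj S A).erase ∅, x ^ A.card := by
    refine sum_congr ?_ fun _ _ => rfl
    ext A
    simp only [mem_erase, mem_filter, Finset.nonempty_iff_ne_empty]
    tauto
  rw [hsplit, Finset.sum_erase_eq_sub hmem, card_empty, pow_zero]
  linarith

end Counting

/-! ## §2 The observable bound with the lattice-animal constant -/

section Bounds

variable {V : Type*} {Ω : Type*} {mΩ : MeasurableSpace Ω} [DecidableEq V] {μ : Measure Ω} {R : V → V → Prop}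
  [DecidableRel R] {𝓕 : V → MeasurableSpace Ω} {g : V → Ω → ℂ} {ε B : ℝ} {F : Ω → ℂ} {S : Finset V}
  {nbr : V → Finset V} {Δ : ℕ}

/-- The renormalised fugacity `ε₁ = ε · exp (2eε(Δ+1)²)` (`≤ e ε` under Dobrushin smallness). -/
def fug (ε : ℝ) (Δ : ℕ) : ℝ := ε * Real.exp (2 * (Real.exp 1 * ε) * ((Δ : ℝ) + 1) ^ 2)

omit [DecidableEq V] [DecidableRel R] in
/-- `fug` is non-negative for `ε ≥ 0`. -/
theorem fug_nonneg (hε : 0 ≤ ε) (Δ : ℕ) : 0 ≤ fug ε Δ := by unfold fug; positivity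

omit [DecidableEq V] [DecidableRel R] in
open scoped Classical in
/-- The elementary estimate, SHARP form: `Σ_{∅ ≠ A ⊆ C seeded by T} ε^{#A} exp (2eε(Δ+1)² #A) ≤ (1 + 2ε₁)^{#T} − 1` under
`(1 + 2ε₁)^Δ ≤ 2` (lattice-animal counting `sum_pow_card_nonempty_le_of_isSeeded_sharp` at `x = ε₁`). -/
theorem sum_seeded_pow_le_sharp (hΔ : ∀ x, (nbr x).card ≤ Δ) (hnbr : ∀ x y, R x y → y ∈ nbr x)
    (hε : 0 ≤ ε) (hsmall3 : (1 + 2 * fug ε Δ) ^ Δ ≤ 2) (C T : Finset V) :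
    ∑ A ∈ (C.powerset.filter fun A => IsSeeded R T A) with A.Nonempty,
        ε ^ A.card * Real.exp (2 * (Real.exp 1 * ε) * ((Δ : ℝ) + 1) ^ 2 * A.card) ≤
      (1 + 2 * fug ε Δ) ^ T.card - 1 := by
  have hterm : ∀ A : Finset V,
      ε ^ A.card * Real.exp (2 * (Real.exp 1 * ε) * ((Δ : ℝ) + 1) ^ 2 * A.card) = fug ε Δ ^ A.card := by
    intro A
    unfold fug
    rw [mul_pow, ← Real.exp_nat_mul]; ring_nf
  simp_rw [hterm]
  exact sum_pow_card_nonempty_le_of_isSeeded_sharp nbr hnbr Δ hΔ (fug_nonneg hε Δ) hsmall3 C T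

open scoped Classical in
/-- The contribution of the non-empty seeded sets, SHARP form:
`‖Σ_{∅ ≠ A seeded} (∫ F ∏_A g) Z(cofree A) / Z(C)‖ ≤ B e^{2eε(Δ+1)#T} ((1 + 2ε₁)^{#T} − 1)`. -/
theorem norm_sum_seeded_nonempty_le_sharp [IsProbabilityMeasure μ] (hR : ∀ x y, R x y → R y x)
    (hΔ : ∀ x, (nbr x).card ≤ Δ) (hnbr : ∀ x y, R x y → y ∈ nbr x)
    (h : IsLocalPerturbation μ R 𝓕 g ε) (hF : IsLocalObservable 𝓕 F S B)
    (hsmall : Real.exp 1 * ε * ((Δ : ℝ) + 1) ^ 2 ≤ 1 / 2) (hsmall3 : (1 + 2 * fug ε Δ) ^ Δ ≤ 2)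
    (hB : 0 ≤ B) (C T : Finset V) :
    ‖∑ A ∈ (C.powerset.filter (IsSeeded R T)) with A.Nonempty,
        obsActivity μ g F A * pertZ μ g (cofree R C T A) / pertZ μ g C‖ ≤
      B * Real.exp (T.card * ((Δ : ℝ) + 1) * (2 * (Real.exp 1 * ε))) * ((1 + 2 * fug ε Δ) ^ T.card - 1) := by
  set c : ℝ := 2 * (Real.exp 1 * ε) with hc
  have hc0 : 0 ≤ c := by have := h.nonneg; positivity
  refine (norm_sum_le _ _).trans ?_
  have hterm : ∀ A ∈ (C.powerset.filter (IsSeeded R T)).filter (fun A => A.Nonempty),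
      ‖obsActivity μ g F A * pertZ μ g (cofree R C T A) / pertZ μ g C‖ ≤
        B * Real.exp (T.card * ((Δ : ℝ) + 1) * c) *
          (ε ^ A.card * Real.exp (2 * (Real.exp 1 * ε) * ((Δ : ℝ) + 1) ^ 2 * A.card)) := by
    intro A _
    rw [mul_div_assoc, norm_mul]
    have h1 := norm_obsActivity_le h hF A
    have h2 := norm_pertZ_cofree_div_le hR hΔ hnbr h hsmall C T A
    have hsplit : Real.exp ((((Δ : ℝ) + 1) * A.card + T.card) * ((Δ : ℝ) + 1) * c) =
        Real.exp (T.card * ((Δ : ℝ) + 1) * c) *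
          Real.exp (2 * (Real.exp 1 * ε) * ((Δ : ℝ) + 1) ^ 2 * A.card) := by
      rw [← Real.exp_add]; congr 1; rw [hc]; ring
    calc ‖obsActivity μ g F A‖ * ‖pertZ μ g (cofree R C T A) / pertZ μ g C‖
        ≤ (B * ε ^ A.card) * Real.exp ((((Δ : ℝ) + 1) * A.card + T.card) * ((Δ : ℝ) + 1) * c) :=
          mul_le_mul h1 h2 (norm_nonneg _) (by have := h.nonneg; positivity)
      _ = _ := by rw [hsplit]; ring
  refine (sum_le_sum hterm).trans ?_
  rw [← mul_sum]
  exact mul_le_mul_of_nonneg_left (sum_seeded_pow_le_sharp hΔ hnbr h.nonneg hsmall3 C T) (by positivity)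

open scoped Classical in
/-- **Ratios of partition functions are close to one, SHARP form**:
`‖1 − Z(C ∖ D)/Z(C)‖ ≤ e^{2eε(Δ+1)#D} ((1 + 2ε₁)^{#D} − 1)`. -/
theorem norm_one_sub_pertZ_sdiff_div_le_sharp [IsProbabilityMeasure μ] (hR : ∀ x y, R x y → R y x)
    (hΔ : ∀ x, (nbr x).card ≤ Δ) (hnbr : ∀ x y, R x y → y ∈ nbr x)
    (h : IsLocalPerturbation μ R 𝓕 g ε) (hsmall : Real.exp 1 * ε * ((Δ : ℝ) + 1) ^ 2 ≤ 1 / 2)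
    (hsmall3 : (1 + 2 * fug ε Δ) ^ Δ ≤ 2) (C D : Finset V) :
    ‖1 - pertZ μ g (C \ D) / pertZ μ g C‖ ≤
      Real.exp (D.card * ((Δ : ℝ) + 1) * (2 * (Real.exp 1 * ε))) * ((1 + 2 * fug ε Δ) ^ D.card - 1) := by
  classical
  have hZ := pertZ_ne_zero hR hΔ hnbr h hsmall C
  have hone := isLocalObservable_one (Ω := Ω) 𝓕
  have hT : touchCells R (∅ : Finset V) C ⊆ D := by
    intro p hp
    obtain ⟨-, w, hw, -⟩ := mem_touchCells.1 hp
    simp at hw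
  have hnum : pertNum μ g (fun _ => (1 : ℂ)) C = pertZ μ g C := by simp [pertNum, pertZ]
  have hid := pertNum_eq_integral_mul_add h hone hT
  rw [hnum] at hid
  simp only [integral_const, probReal_univ, one_smul, one_mul] at hid
  have hkey : 1 - pertZ μ g (C \ D) / pertZ μ g C =
      ∑ A ∈ (C.powerset.filter (IsSeeded R D)) with A.Nonempty,
        obsActivity μ g (fun _ => (1 : ℂ)) A * pertZ μ g (cofree R C D A) / pertZ μ g C := by
    rw [← sum_div, eq_div_iff hZ, sub_mul, div_mul_cancel₀ _ hZ, one_mul]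
    exact sub_eq_of_eq_add' hid
  rw [hkey]
  have := norm_sum_seeded_nonempty_le_sharp hR hΔ hnbr h hone hsmall hsmall3 zero_le_one C D
  simpa using this

open scoped Classical in
/-- **Perturbed expectations of local observables — Kotecký–Preiss-grade constant.**  Under `eε(Δ+1)² ≤ 1/2` and
`(1 + 2ε₁)^Δ ≤ 2` (`ε₁ = ε e^{2eε(Δ+1)²}`), for a local observable `F` (cells `S`, bound `B`), every finite `C` and
`T = touchCells R S C`: `‖⟨F⟩_C − ∫ F dμ‖ ≤ 2 B e^{2eε(Δ+1)#T} ((1 + 2ε₁)^{#T} − 1)` — of order `B (Δ+1)² #S ε`, against the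
tree's `2 e B ε 2^Δ (2e)^{#T}` (`norm_pertExpect_sub_integral_le`, Peierls counting). -/
theorem norm_pertExpect_sub_integral_le_sharp [IsProbabilityMeasure μ] (hR : ∀ x y, R x y → R y x)
    (hΔ : ∀ x, (nbr x).card ≤ Δ) (hnbr : ∀ x y, R x y → y ∈ nbr x)
    (h : IsLocalPerturbation μ R 𝓕 g ε) (hF : IsLocalObservable 𝓕 F S B)
    (hsmall : Real.exp 1 * ε * ((Δ : ℝ) + 1) ^ 2 ≤ 1 / 2) (hsmall3 : (1 + 2 * fug ε Δ) ^ Δ ≤ 2)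
    (C : Finset V) :
    ‖pertExpect μ g F C - ∫ ω, F ω ∂μ‖ ≤
      2 * B * Real.exp ((touchCells R S C).card * ((Δ : ℝ) + 1) * (2 * (Real.exp 1 * ε))) *
        ((1 + 2 * fug ε Δ) ^ (touchCells R S C).card - 1) := by
  classical
  set T := touchCells R S C with hTdef
  have hZ := pertZ_ne_zero hR hΔ hnbr h hsmall C
  by_cases hΩ : Nonempty Ω
  swap
  · exact absurd (inferInstance : IsProbabilityMeasure μ) (by
      intro hμ; have := hμ.measure_univ
      rw [Set.univ_eq_empty_iff.2 (not_nonempty_iff.1 hΩ), measure_empty] at this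
      exact zero_ne_one this)
  have hB : 0 ≤ B := hF.nonneg hΩ.some
  have hid := pertNum_eq_integral_mul_add h hF (subset_refl T)
  have hkey : pertExpect μ g F C - ∫ ω, F ω ∂μ =
      (∫ ω, F ω ∂μ) * (pertZ μ g (C \ T) / pertZ μ g C - 1) +
        ∑ A ∈ (C.powerset.filter (IsSeeded R T)) with A.Nonempty,
          obsActivity μ g F A * pertZ μ g (cofree R C T A) / pertZ μ g C := by
    unfold pertExpect
    rw [hid, ← sum_div, add_div, mul_div_assoc]
    ring
  rw [hkey]
  refine (norm_add_le _ _).trans ?_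
  have hI : ‖∫ ω, F ω ∂μ‖ ≤ B := by
    have := norm_integral_le_of_norm_le_const (μ := μ) (f := F) (C := B)
      (Filter.Eventually.of_forall hF.norm_le)
    rwa [probReal_univ, mul_one] at this
  set K : ℝ := Real.exp (T.card * ((Δ : ℝ) + 1) * (2 * (Real.exp 1 * ε))) * ((1 + 2 * fug ε Δ) ^ T.card - 1) with hK
  have hK0 : 0 ≤ K := by
    have h1 : (1 : ℝ) ≤ (1 + 2 * fug ε Δ) ^ T.card := one_le_pow₀ (by linarith [fug_nonneg h.nonneg Δ])
    rw [hK]; exact mul_nonneg (Real.exp_pos _).le (by linarith)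
  have h1 : ‖(∫ ω, F ω ∂μ) * (pertZ μ g (C \ T) / pertZ μ g C - 1)‖ ≤ B * K := by
    rw [norm_mul, norm_sub_rev]
    exact mul_le_mul hI (norm_one_sub_pertZ_sdiff_div_le_sharp hR hΔ hnbr h hsmall hsmall3 C T) (norm_nonneg _) hB
  have h2 := norm_sum_seeded_nonempty_le_sharp hR hΔ hnbr h hF hsmall hsmall3 hB C T
  calc ‖(∫ ω, F ω ∂μ) * (pertZ μ g (C \ T) / pertZ μ g C - 1)‖ +
        ‖∑ A ∈ (C.powerset.filter (IsSeeded R T)) with A.Nonempty,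
          obsActivity μ g F A * pertZ μ g (cofree R C T A) / pertZ μ g C‖
      ≤ B * K + B * K := add_le_add h1 (by rw [hK, ← mul_assoc]; exact h2)
    _ = 2 * B * K := by ring
    _ = _ := by rw [hK]; ring

end Bounds

end Summit.QuantumFields.YangMills.Cruxes.IR.BlockedActivity.KP

end
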